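import Summits.Ventures.PercRepro.RankLevelSetCoreSixColoopFreeFlatCap
import Summits.Ventures.PercRepro.RankLevelSetDepCountHeavyWin
import Summits.Ventures.PercRepro.RankLevelSetLevelSixCapGlue25
import Summits.Ventures.PercRepro.RankLevelSetTheoremC

/-!
# PercRepro — THE CELL `(23, 8)` WITH A `12`-POINT RANK-`5` SET: `#U ≤ 19·Σ_{5 ≤ i ≤ 7} C(12, i)` (p8 g11, S3)

`proofs/SUBCLAIM-S3-p8.md` §3y. On a coloop-free `e`-free core of rank `23` and corank `8` a set `H` of rank `≤ 5` has at most
`4 + 8 = 12` points (the coloop-free flat cap); if it HAS `12`, then for every `A ∈ U` (`r(A) = 23`, `r(E ∖ A) = 6`) the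
complement `B = E ∖ A` leaves `H` in exactly one point: `23 = r(A) ≤ r(A ∩ H) + |A ∖ H| ≤ 5 + (19 − |B ∖ H|)` forces
`|B ∖ H| ≤ 1`, and `B ⊄ H` since `r(B) = 6 > 5`. So `A ↦ (B ∖ H, B ∩ H)` injects `U` into
`{x ∈ E ∖ H} × {Y ⊆ H : 5 ≤ |Y| ≤ 7}` (`|B| ≤ 8` as `|A| ≥ r(A) = 23`, `|B| ≥ r(B) = 6`): `#U ≤ 19·2508 = 47 652`, against
`#Y ≥ 2^{31} − Σ_{j ≤ 13} C(31, j) − Σ_{j ≤ 8} C(31, j)` (every rank-`≤ 6` set has `≤ 13` points, the spanning sets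
`≤ Σ_{j ≤ 8} C(31, j)`) and `Φ(23, 6) ≤ 2^{29}/C(29, 6)`: ratio `≈ 0.04`. This is the first half of the two-case split of the
cell `(23, 8)`; the second half (no rank-`≤ 5` set of `12` points, so `UH = ∅` and the `H`-window of the cell `sq27di2v` is
void) is RankLevelSetLevelSixT23Cell8. Axioms: standard.
-/

open scoped Matroid

namespace PercRepro

namespace ThmN

open Set

variable {α : Type}

/-- **The cell `(23, 8)` WITH a `12`-point set of rank `≤ 5`.** -/
theorem c025_core_six_t23_eight_bigflat (M : Matroid α) [M.Finite] (hcf : ∀ e ∈ M.E, ¬ M.IsColoop e)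
    (hR : M.eRank = (23 : ℕ∞)) (hn : M.E.ncard = 23 + 8)
    (_hfree : ∀ e ∈ M.E, ∃ A ⊆ M.E \ {e}, e ∉ M.closure A ∧ e ∉ M.closure ((M.E \ {e}) \ A))
    {H : Set α} (hH : H ⊆ M.E) (hH5 : M.eRk H ≤ 5) (hH12 : 12 ≤ H.ncard) :
    RLS M 23 6 := by
  classical
  have hEcard : M.ground_finite.toFinset.card = 23 + 8 := by
    rw [← Set.ncard_eq_toFinset_card _ M.ground_finite]; exact hn
  have hd : M.E.encard = M.eRank + (8 : ℕ) := by
    rw [hR, ← M.ground_finite.cast_ncard_eq, hn]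
    push_cast
    ring
  have hHfin : H.Finite := M.ground_finite.subset hH
  have hH12' : H.ncard = 12 := by
    have := ncard_le_four_add_of_coloopFree M hcf hR hn (by norm_num) hH hH5
    omega
  have hDfin : (M.E \ H).Finite := M.ground_finite.subset Set.sdiff_subset
  have hD19 : (M.E \ H).ncard = 19 := by
    rw [Set.ncard_sdiff' hH M.ground_finite, hn, hH12']
  -- (U): every `A ∈ U` has `|(E ∖ A) ∖ H| = 1` and `5 ≤ |(E ∖ A) ∩ H| ≤ 7`
  have hU : Matroid.topCount M 23 6 ≤ 19 * ∑ i ∈ Finset.Icc 5 7, Nat.choose 12 i := by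
    unfold Matroid.topCount
    have hfin : ({X : Set α | X ⊆ (hDfin.toFinset : Set α) ∧ X.ncard = 1} ×ˢ
        {Y : Set α | Y ⊆ (hHfin.toFinset : Set α) ∧ 5 ≤ Y.ncard ∧ Y.ncard ≤ 7}).Finite :=
      ((Finset.finite_toSet _).finite_subsets.subset (fun X hX => hX.1)).prod
        ((Finset.finite_toSet _).finite_subsets.subset (fun Y hY => hY.1))
    have hinj : {A : Set α | A ⊆ M.E ∧ M.eRk A = ((23 : ℕ) : ℕ∞) ∧ M.eRk (M.E \ A) = ((6 : ℕ) : ℕ∞)}.ncard ≤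
        ({X : Set α | X ⊆ (hDfin.toFinset : Set α) ∧ X.ncard = 1} ×ˢ
          {Y : Set α | Y ⊆ (hHfin.toFinset : Set α) ∧ 5 ≤ Y.ncard ∧ Y.ncard ≤ 7}).ncard := by
      refine Set.ncard_le_ncard_of_injOn (fun A => ((M.E \ A) \ H, (M.E \ A) ∩ H)) ?_ ?_ hfin
      · intro A hA
        obtain ⟨hAE, hrA, hrB⟩ := hA
        set B := M.E \ A with hBdef
        have hBE : B ⊆ M.E := Set.sdiff_subset
        have hBfin : B.Finite := M.ground_finite.subset hBE
        have hAfin : A.Finite := M.ground_finite.subset hAE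
        -- `|A| ≥ 23`, `|B| ≤ 8`, `|B| ≥ 6`
        have hA23 : 23 ≤ A.ncard := by
          have := M.eRk_le_encard A
          rw [hrA, ← hAfin.cast_ncard_eq] at this
          exact_mod_cast this
        have hB6 : 6 ≤ B.ncard := by
          have := M.eRk_le_encard B
          rw [hrB, ← hBfin.cast_ncard_eq] at this
          exact_mod_cast this
        have hAB : A.ncard + B.ncard = M.E.ncard := by
          rw [hBdef, Set.ncard_sdiff' hAE M.ground_finite]
          have := Set.ncard_le_ncard hAE M.ground_finite
          omega
        have hB8 : B.ncard ≤ 8 := by omega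
        -- `|B ∖ H| ≤ 1` by the rank of `A`
        have hAH : M.eRk A ≤ M.eRk (A ∩ H) + M.eRk (A \ H) := by
          have := M.eRk_union_le_eRk_add_eRk (A ∩ H) (A \ H)
          rwa [Set.inter_union_sdiff] at this
        have h1 : M.eRk (A ∩ H) ≤ 5 := (M.eRk_mono Set.inter_subset_right).trans hH5
        have h2 : M.eRk (A \ H) ≤ ((A \ H).ncard : ℕ∞) := by
          rw [(hAfin.subset Set.sdiff_subset).cast_ncard_eq]; exact M.eRk_le_encard _
        have hsplit : (A \ H).ncard + (B \ H).ncard = 19 := by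
          have hdisj : Disjoint (A \ H) (B \ H) :=
            Set.disjoint_left.2 (fun x hx hx' => hx'.1.2 hx.1)
          have hunion : (A \ H) ∪ (B \ H) = M.E \ H := by
            ext x
            simp only [Set.mem_union, Set.mem_sdiff, hBdef]
            constructor
            · rintro (⟨hxA, hxH⟩ | ⟨⟨hxE, _⟩, hxH⟩)
              · exact ⟨hAE hxA, hxH⟩
              · exact ⟨hxE, hxH⟩
            · rintro ⟨hxE, hxH⟩
              by_cases hxA : x ∈ A
              · exact Or.inl ⟨hxA, hxH⟩
              · exact Or.inr ⟨⟨hxE, hxA⟩, hxH⟩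
          rw [← hD19, ← hunion, Set.ncard_union_eq hdisj (hAfin.subset Set.sdiff_subset) (hBfin.subset Set.sdiff_subset)]
        have hBH1 : (B \ H).ncard ≤ 1 := by
          have h3 : M.eRk A ≤ 5 + ((A \ H).ncard : ℕ∞) := hAH.trans (add_le_add h1 h2)
          rw [hrA] at h3
          have h4 : (23 : ℕ) ≤ 5 + (A \ H).ncard := by exact_mod_cast h3
          omega
        -- `B ⊄ H`
        have hBnot : ¬ B ⊆ H := by
          intro hsub
          have := (M.eRk_mono hsub).trans hH5
          rw [hrB] at this
          have : (6 : ℕ) ≤ 5 := by exact_mod_cast this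
          omega
        have hBH1' : (B \ H).ncard = 1 := by
          have hne : (B \ H).Nonempty := by
            rw [Set.nonempty_iff_ne_empty]
            intro h0
            exact hBnot (Set.sdiff_eq_empty.1 h0)
          have := Set.ncard_pos (hBfin.subset Set.sdiff_subset) |>.2 hne
          omega
        have hBsplit : B.ncard = (B \ H).ncard + (B ∩ H).ncard := by
          have hdis : Disjoint (B \ H) (B ∩ H) := Set.disjoint_left.2 (fun y hy hy' => hy.2 hy'.2)
          rw [← Set.ncard_union_eq hdis (hBfin.subset Set.sdiff_subset) (hBfin.subset Set.inter_subset_left),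
            Set.sdiff_union_inter]
        rw [Set.mem_prod]
        refine ⟨⟨?_, hBH1'⟩, ⟨?_, ?_, ?_⟩⟩
        · rw [Set.Finite.coe_toFinset]
          exact fun y hy => ⟨hBE hy.1, hy.2⟩
        · rw [Set.Finite.coe_toFinset]
          exact Set.inter_subset_right
        · show 5 ≤ (B ∩ H).ncard
          omega
        · show (B ∩ H).ncard ≤ 7
          omega
      · intro A hA A' hA' h
        simp only [Prod.mk.injEq] at h
        have e1 : M.E \ A = M.E \ A' := by
          rw [← Set.sdiff_union_inter (M.E \ A) H, ← Set.sdiff_union_inter (M.E \ A') H, h.1, h.2]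
        have hAE : A ⊆ M.E := hA.1
        have hA'E : A' ⊆ M.E := hA'.1
        rw [← Set.sdiff_sdiff_cancel_left hAE, ← Set.sdiff_sdiff_cancel_left hA'E, e1]
    rw [Set.ncard_prod] at hinj
    have h1 : {X : Set α | X ⊆ (hDfin.toFinset : Set α) ∧ X.ncard = 1}.ncard = 19 := by
      have := ncard_subsets_ncard_eq hDfin.toFinset 1
      rw [Nat.choose_one_right, ← Set.ncard_eq_toFinset_card _ hDfin, hD19] at this
      exact this
    have h2 : {Y : Set α | Y ⊆ (hHfin.toFinset : Set α) ∧ 5 ≤ Y.ncard ∧ Y.ncard ≤ 7}.ncard ≤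
        ∑ j ∈ Finset.Icc 5 7, Nat.choose 12 j := by
      have := ncard_subsets_ncard_window hHfin.toFinset 5 7
      rwa [← Set.ncard_eq_toFinset_card _ hHfin, hH12'] at this
    calc _ ≤ _ := hinj
      _ = 19 * {Y : Set α | Y ⊆ (hHfin.toFinset : Set α) ∧ 5 ≤ Y.ncard ∧ Y.ncard ≤ 7}.ncard := by rw [h1]
      _ ≤ 19 * ∑ j ∈ Finset.Icc 5 7, Nat.choose 12 j := Nat.mul_le_mul_left _ h2
  -- (Y)
  have hY := Matroid.two_pow_le_midCount_add (M := M) 23 6 hR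
  have hB := Matroid.ncard_spanning_le (M := M) hd
  rw [hEcard] at hY hB
  have hA : {X : Set α | X ⊆ M.E ∧ M.eRk X ≤ 6}.ncard ≤ ∑ j ∈ Finset.range (13 + 1), (23 + 8).choose j := by
    have h1 : {X : Set α | X ⊆ M.E ∧ M.eRk X ≤ 6}.ncard ≤
        {X : Set α | X ⊆ (M.ground_finite.toFinset : Set α) ∧ X.ncard ≤ 13}.ncard := by
      apply Set.ncard_le_ncard
      · intro X hX
        refine ⟨by rw [Set.Finite.coe_toFinset]; exact hX.1, ?_⟩
        have := ncard_le_five_add_of_coloopFree M hcf hR hn (by norm_num) hX.1 hX.2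
        omega
      · exact (Finset.finite_toSet _).finite_subsets.subset (fun X hX => hX.1)
    have h2 := ncard_subsets_ncard_le M.ground_finite.toFinset 13
    rw [hEcard] at h2
    exact h1.trans h2
  -- assemble in `ℚ`
  have hΦ := phiK_le_two_pow_div_six 23
  rw [RLS_iff]
  have hUq : (Matroid.topCount M 23 6 : ℚ) ≤ 47652 := by
    have hnum : (19 * ∑ i ∈ Finset.Icc 5 7, Nat.choose 12 i : ℕ) = 47652 := by
      rw [show Finset.Icc 5 7 = Finset.Ico 5 8 from (Finset.Ico_succ_right_eq_Icc 5 7).symm, Finset.sum_Ico_eq_sum_range]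
      norm_num [Finset.sum_range_succ, Nat.choose]
    have h := hU; rw [hnum] at h
    exact_mod_cast h
  have hYq : (2 : ℚ) ^ (23 + 8) ≤ (Matroid.midCount M 23 6 : ℚ) +
      ({X : Set α | X ⊆ M.E ∧ M.eRk X ≤ 6}.ncard : ℚ) + ({X : Set α | X ⊆ M.E ∧ M.eRk X = M.eRank}.ncard : ℚ) := by
    exact_mod_cast hY
  have hAq : ({X : Set α | X ⊆ M.E ∧ M.eRk X ≤ 6}.ncard : ℚ) ≤ 508019104 := by
    have h : (∑ j ∈ Finset.range (13 + 1), (23 + 8).choose j : ℕ) = 508019104 := by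
      norm_num [Finset.sum_range_succ, Nat.choose]
    have h' := hA; rw [h] at h'
    exact_mod_cast h'
  have hBq : ({X : Set α | X ⊆ M.E ∧ M.eRk X = M.eRank}.ncard : ℚ) ≤ 11460949 := by
    have h : (∑ j ∈ Finset.range (8 + 1), (23 + 8).choose j : ℕ) = 11460949 := by
      norm_num [Finset.sum_range_succ, Nat.choose]
    have h' := hB; rw [h] at h'
    exact_mod_cast h'
  have hΦ' : phiK 23 6 ≤ (2 : ℚ) ^ 29 / 475020 := by
    have h : (((23 + 6).choose 6 : ℕ) : ℚ) = 475020 := by norm_num [Nat.choose]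
    rw [h] at hΦ
    exact hΦ
  have hU0 : (0 : ℚ) ≤ (Matroid.topCount M 23 6 : ℚ) := Nat.cast_nonneg _
  have hΦ0 : (0 : ℚ) ≤ phiK 23 6 := by
    unfold phiK
    positivity
  calc phiK 23 6 * (Matroid.topCount M 23 6 : ℚ) ≤ ((2 : ℚ) ^ 29 / 475020) * 47652 :=
        mul_le_mul hΦ' hUq hU0 (by positivity)
    _ ≤ (Matroid.midCount M 23 6 : ℚ) := by
        have : (2 : ℚ) ^ (23 + 8) = 2147483648 := by norm_num
        rw [this] at hYq
        norm_num
        linarith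

end ThmN

end PercRepro
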